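import Mathlib
import Summits.PneNP.PneNP.Theses.OverlapGapAlgebra
import Summits.PneNP.PneNP.Theorems.OverlapGapAlgebraSearchHardWindowCore

/-!
# Strategy census, pass 3 — Lean spine (crux stmt-PneNP-2460 `SearchHardWindow`)

Kernel-checked forms of the two structural facts used in `STRATEGY-CENSUS.md` (pass 3, §1):

* `hardAtWindow` — the bare hardness conjunct `H(k, α_k)` of the crux at the window density
  `α_k = 5·2^k·log k/k` (verbatim the `hhard` binder of the tree theorem
  `searchHardWindow_of_hard_at_window`).
* `simKernel_gives_pneNP` — **every simulation kernel is summit-strength**: for ANY property `Tame` of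
  word functions, a "rung" (`Tame`-maps fail at the window, a theorem of probability for every tameness
  class landed so far) together with a "kernel" (`every poly-time f has Tame`) proves `PneNP` outright,
  through `searchHardWindow_of_hard_at_window` and `searchHardWindow_implies_pneNP`. So no kernel of
  the shape `∀ f, IsPolyTime f → Tame f` with a provable rung can be weaker than the summit.
* `deferredFact_gives_pneNP` — the "two open pieces" shape `A ∧ (A → H)`: once the f-free piece `A`
  is a theorem, the other piece proves `PneNP`; i.e. deferring a fact hides, but does not remove, the
  summit-strength of the kernel.

Strategist `planner-cstrat-stmt-PneNP-2460-p1-0`, 2026-08-17. No `sorry`.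
-/

namespace Summit.PneNP.PneNP.Cruxes.SearchHardWindow.Census3

set_option linter.dupNamespace false

open Filter Literature.Computability.Complexity
open Summit.PneNP.PneNP.Theses.OverlapGapAlgebra
open Summit.PneNP.PneNP.Theorems

/-- Success ratio of the word function `f` on `F_k(n, m)` (verbatim the crux's counting ratio). -/
noncomputable def successRatio (k n m : ℕ) (f : List Bool → List Bool) : ℝ :=
  ((Finset.univ.filter fun Φ : Fin m → Fin k → Fin n × Bool => ∀ i, ∃ j,
      (f (encodingCNF.encode (List.ofFn fun a => List.ofFn fun b =>
        (((Φ a b).1 : ℕ), (Φ a b).2)))).getD (Φ i j).1 false = (Φ i j).2).card : ℝ) /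
    Fintype.card (Fin m → Fin k → Fin n × Bool)

/-- `FailsAtWindow k f`: the map `f` solves `F_k(n, ⌊α_k n⌋)` with probability `→ 0`. -/
def FailsAtWindow (k : ℕ) (f : List Bool → List Bool) : Prop :=
  ∀ ε : ℝ, 0 < ε → ∀ᶠ n : ℕ in atTop, ∀ m : ℕ, m = ⌊5 * 2 ^ k * Real.log k / k * n⌋₊ →
    successRatio k n m f ≤ ε

/-- The bare hardness conjunct `H(k, α_k)`: every polynomial-time `f` fails at the window. -/
def hardAtWindow (k : ℕ) : Prop :=
  ∀ f : List Bool → List Bool, IsPolyTime f → FailsAtWindow k f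

/-- `H(k, α_k)` for one `k ≥ 1024` gives the crux (tree: `searchHardWindow_of_hard_at_window`). -/
theorem searchHardWindow_of_hardAtWindow {k : ℕ} (hk : 1024 ≤ k) (h : hardAtWindow k) :
    SearchHardWindow :=
  searchHardWindow_of_hard_at_window hk (fun f hf ε hε => h f hf ε hε)

/-- `H(k, α_k)` for one `k ≥ 1024` gives the summit (tree: `searchHardWindow_implies_pneNP`). -/
theorem pneNP_of_hardAtWindow {k : ℕ} (hk : 1024 ≤ k) (h : hardAtWindow k) : _root_.PneNP :=
  searchHardWindow_implies_pneNP (searchHardWindow_of_hardAtWindow hk h)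

/-- **Every simulation kernel is summit-strength.** For ANY property `Tame` of word functions: a rung
(`Tame`-maps fail at the window) plus a simulation kernel (`poly-time ⇒ Tame`) proves `PneNP`. -/
theorem simKernel_gives_pneNP {k : ℕ} (hk : 1024 ≤ k) (Tame : (List Bool → List Bool) → Prop)
    (hRung : ∀ f, Tame f → FailsAtWindow k f)
    (hSim : ∀ f, IsPolyTime f → Tame f) : _root_.PneNP :=
  pneNP_of_hardAtWindow hk (fun f hf => hRung f (hSim f hf))

/-- Conversely the kernel is a COROLLARY of `H(k, α_k)` whenever `Tame` is implied by failure — so for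
the natural choice `Tame := FailsAtWindow k` itself (the weakest rung-compatible property) kernel and
core coincide: `(∀ f, IsPolyTime f → Tame f) ↔ hardAtWindow k`. -/
theorem simKernel_iff_hard (k : ℕ) (Tame : (List Bool → List Bool) → Prop)
    (hRung : ∀ f, Tame f → FailsAtWindow k f) (hBack : ∀ f, FailsAtWindow k f → Tame f) :
    (∀ f, IsPolyTime f → Tame f) ↔ hardAtWindow k :=
  ⟨fun hSim f hf => hRung f (hSim f hf), fun hH f hf => hBack f (hH f hf)⟩

/-- **Deferred fact.** The "two open pieces" shape `A ∧ (A → H)`: as soon as the f-free piece `A`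
holds, the complexity piece alone proves the summit. -/
theorem deferredFact_gives_pneNP {k : ℕ} (hk : 1024 ≤ k) (A : Prop)
    (hKernel : A → hardAtWindow k) (hA : A) : _root_.PneNP :=
  pneNP_of_hardAtWindow hk (hKernel hA)

end Summit.PneNP.PneNP.Cruxes.SearchHardWindow.Census3
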